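import Literature.AlgebraicGeometry.AbelianSchemes.AbelianSchemeSymplecticLevel
import Literature.AlgebraicGeometry.Motives.AbelianVarietyWeilPairingPullback
import Literature.AlgebraicGeometry.Motives.AbelianVarietyWeilPairingDivisorClass
import HarnessLib

/-!
# Symplectic lifts and symplectic-liftability transfer along isomorphisms of fibres
# ([Lan2013PELCompactifications] Lemma 1.3.6.5/1.3.6.6 are statements about the geometric fibre; [MumfordAV1970] §20 (3))

Cell `hodgecm-mathlib`, M1PRIME-DAG rung 0, road D-BC∃ («pull-back of a `PolarizedAbelianSchemeWithLevel` along a base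
change EXISTS»), the D3 THIRD (B-p06 g6; signature block 2026-08-29 00:06:29Z; assembler B-p13): the `symplectic`
clause `LevelStructure.IsSymplecticLiftable` of the moduli object (★ `AbelianSchemeSymplecticLevel`, [Lan] Def. 1.3.6.2
via Lemma 1.3.6.6) is tested geometric point by geometric point, and AT a geometric point it is a statement about the
fibre abelian variety `A_s̄` with its level sections and the Weil pairing of an ample witness of the polarisation —
so it TRANSPORTS along any isomorphism of fibre abelian varieties compatible with the sections and the polarisation.
This file proves exactly that, def-free:

* `LevelStructure.SymplecticLift.nonempty_of_linEquiv` (T0) — a symplectic lift for `Θ` is one for every linearly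
  equivalent `Θ′` (the pairing `ē^Θ_M` depends only on the class of `Θ`, ★ `weilPairingLevel_congr_linEquiv`);
* `LevelStructure.SymplecticLift.nonempty_transport` (T1) — transport of a symplectic lift along an isomorphism
  `e : A′_{s′} ≅ A_s` of fibre abelian varieties carrying the sections of `φ′` at `s′` to those of `φ` at `s`: same
  roots `ζ_M`, `lift′ := e⁻¹ ∘ lift`, pairing clause by Mumford's functoriality `ē^{e^*Θ}(e⁻¹P, e⁻¹Q) = ē^Θ(P, Q)`
  (★ `weilPairingLevel_pullback_eq`);
* `LevelStructure.IsSymplecticLiftable.of_fibreIso` (T2) — liftability transfers along a family of such fibre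
  isomorphisms `e Ω s′ : A′_{s′} ≅ A_{s′ ≫ f}` (`he`: sections; `hpol`: ampleness + `IsLambdaOfAt` along `e⁻¹`);
  the D-BC∃ assembly instantiates `A′ := A.baseChange f`, `e := fibreBaseChangeIso` (B-p02), `he` (B-p13), `hpol`
  (B-p02).

Theorems only; no definition, no named fact, no instance, no `sorry`.  HC_CM is proved only modulo the 7 printed
citations until rung 0 closes; nothing here discharges a binder.

## References
* [Lan2013PELCompactifications] K.-W. Lan, *Arithmetic compactifications of PEL-type Shimura varieties* (2013), §1.3.6
  Def. 1.3.6.2, Lemma 1.3.6.5, Lemma 1.3.6.6, Cor. 1.3.6.7 (pp. 80–82).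
* [MumfordAV1970] D. Mumford, *Abelian Varieties* (1970), §20, property (3) of `e_n` (p. 186).
* [Lang1983AbelianVarieties] S. Lang, *Abelian Varieties*, Ch. VII §2 Prop. 3.
-/

noncomputable section

universe u

open CategoryTheory CategoryTheory.Limits AlgebraicGeometry

namespace Literature.AlgebraicGeometry.AbelianSchemes

namespace AbelianSchemeOver

open Literature.AlgebraicGeometry.Motives
open scoped MonObj

variable {S S' : Scheme.{u}} {A : AbelianSchemeOver S} {A' : AbelianSchemeOver S'} {g N : ℕ}
  {φ : A.LevelStructure g N} {φ' : A'.LevelStructure g N} {Ω : Type u} [Field Ω]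
  {s : Spec (.of Ω) ⟶ S} {s' : Spec (.of Ω) ⟶ S'} {δ : Fin g → ℕ}

/-- **(T0) A symplectic lift for `Θ` is a symplectic lift for every linearly equivalent `Θ′`** — the Weil pairing
`ē^Θ_M` depends only on the linear equivalence class of `Θ` (★ `weilPairingLevel_congr_linEquiv`), all other
fields do not mention `Θ`.  (D3's owed «`∀ Θ`» lemma: two ample witnesses of the same `λ̄` give the same pairing.)
[cite: Lang1983AbelianVarieties, Ch. VII §2 Prop. 3] [cite: Lan2013PELCompactifications, §1.3.6 Lemma 1.3.6.5 (p. 81)] -/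
theorem LevelStructure.SymplecticLift.nonempty_of_linEquiv
    {Θ Θ' : CartierDivisor (A.fibre s).toAbelianVariety.X.left} (h : Θ.LinEquiv Θ')
    (Λ : φ.SymplecticLift s Θ δ) : Nonempty (φ.SymplecticLift s Θ' δ) :=
  ⟨{ ζ := Λ.ζ
     isPrimitiveRoot_ζ := Λ.isPrimitiveRoot_ζ
     ζ_pow := Λ.ζ_pow
     lift := Λ.lift
     lift_bijective := Λ.lift_bijective
     lift_compat := Λ.lift_compat
     lift_level := Λ.lift_level
     pairing := fun M hM hMΩ x y => by
       haveI := AbelianVariety.isDominant_toSchemeHom_zsmul_of_ne_zero (A.fibre s).toAbelianVariety hMΩ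
       rw [← AbelianVariety.weilPairingLevel_congr_linEquiv h]
       exact Λ.weilPairingLevel_lift hM hMΩ x y }⟩

/-- **(T1) TRANSPORT of a symplectic lift along an isomorphism of fibre abelian varieties compatible with the level
sections.**  Let `e : A′_{s′} ≅ A_s` be an isomorphism of abelian varieties over `Ω` between the fibre of `A′/S′` at
`s′` and the fibre of `A/S` at `s` which carries the sections of `φ′` at `s′` to those of `φ` at `s`
(`he : e(σ′ᵢ(s′)) = σᵢ(s)`).  Then a symplectic lift `Λ` of `φ` at `s` for the witness `Θ` yields a symplectic lift
of `φ′` at `s′` for `e^*Θ`: same roots `ζ_M`, `lift′_M := e⁻¹ ∘ lift_M` (bijective, tower-compatible, equal to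
`φ′(s′)` at level `N` by `he`), and the pairing clause is Mumford's functoriality
`ē^{e^*Θ}_M(e⁻¹P, e⁻¹Q) = ē^Θ_M(P, Q)` (★ `weilPairingLevel_pullback_eq`).  [Lan] Lemma 1.3.6.5 speaks of the
geometric fibre only, hence transports along `e`. [cite: MumfordAV1970, §20 (property (3) of e_n, p. 186)]
[cite: Lan2013PELCompactifications, §1.3.6 Lemma 1.3.6.5 (p. 81)] -/
theorem LevelStructure.SymplecticLift.nonempty_transport
    (e : (A'.fibre s').toAbelianVariety ≅ (A.fibre s).toAbelianVariety)
    (he : ∀ i : Fin g ⊕ Fin g,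
      AlgPoints.map e.hom.hom.hom.hom (A'.restrictPt s' (φ'.σ i)) = A.restrictPt s (φ.σ i))
    {Θ : CartierDivisor (A.fibre s).toAbelianVariety.X.left} (Λ : φ.SymplecticLift s Θ δ) :
    haveI := AbelianVariety.isDominant_toSchemeHom_iso_hom e
    Nonempty (φ'.SymplecticLift s' (Θ.pullback (AbelianVariety.Hom.toSchemeHom e.hom)) δ) := by
  haveI := AbelianVariety.isDominant_toSchemeHom_iso_hom e
  -- the maps on `Ω`-points induced by `e` and `e⁻¹`
  let fwd : (A'.fibre s').toAbelianVariety.Points Ω →* (A.fibre s).toAbelianVariety.Points Ω :=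
    IsMonHom.monoidHom e.hom.hom.hom.hom (specOver Ω Ω)
  let bwd : (A.fibre s).toAbelianVariety.Points Ω →* (A'.fibre s').toAbelianVariety.Points Ω :=
    IsMonHom.monoidHom e.inv.hom.hom.hom (specOver Ω Ω)
  have hfwd : ∀ P, fwd P = AlgPoints.map e.hom.hom.hom.hom P := fun P => rfl
  have hfb : ∀ P, fwd (bwd P) = P := fun P => by
    change AlgPoints.map e.hom.hom.hom.hom (AlgPoints.map e.inv.hom.hom.hom P) = P
    rw [← AlgPoints.map_comp_apply]
    change AlgPoints.map (e.inv ≫ e.hom).hom.hom.hom P = P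
    rw [e.inv_hom_id]
    exact AlgPoints.map_id_apply P
  have hbf : ∀ P, bwd (fwd P) = P := fun P => by
    change AlgPoints.map e.inv.hom.hom.hom (AlgPoints.map e.hom.hom.hom.hom P) = P
    rw [← AlgPoints.map_comp_apply]
    change AlgPoints.map (e.hom ≫ e.inv).hom.hom.hom P = P
    rw [e.hom_inv_id]
    exact AlgPoints.map_id_apply P
  -- `e⁻¹` on the `M`-torsion
  have hbwd_mem : ∀ (M : ℕ) (P : (A.fibre s).toAbelianVariety.torsionPoints Ω (M : ℤ)),
      bwd P ∈ (A'.fibre s').toAbelianVariety.torsionPoints Ω (M : ℤ) := fun M P => by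
    rw [AbelianVariety.mem_torsionPoints_iff, ← map_zpow, (AbelianVariety.mem_torsionPoints_iff _ _).1 P.2,
      map_one]
  let bwdT : ∀ M : ℕ, (A.fibre s).toAbelianVariety.torsionPoints Ω (M : ℤ) →*
      (A'.fibre s').toAbelianVariety.torsionPoints Ω (M : ℤ) := fun M =>
    (bwd.comp ((A.fibre s).toAbelianVariety.torsionPoints Ω (M : ℤ)).subtype).codRestrict _ (hbwd_mem M)
  have hbwdT : ∀ (M : ℕ) (P : (A.fibre s).toAbelianVariety.torsionPoints Ω (M : ℤ)),
      ((bwdT M P : (A'.fibre s').toAbelianVariety.torsionPoints Ω (M : ℤ)) :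
        (A'.fibre s').toAbelianVariety.Points Ω) = bwd P := fun M P => rfl
  refine ⟨{ ζ := Λ.ζ
            isPrimitiveRoot_ζ := Λ.isPrimitiveRoot_ζ
            ζ_pow := Λ.ζ_pow
            lift := fun M => (bwdT M).comp (Λ.lift M)
            lift_bijective := ?_
            lift_compat := ?_
            lift_level := ?_
            pairing := ?_ }⟩
  · -- bijectivity: `e⁻¹` is a bijection on torsion points
    intro M hM hM₀
    have hinj : Function.Injective (bwdT M) := fun P Q hPQ => by
      have h := congrArg (fun R : (A'.fibre s').toAbelianVariety.torsionPoints Ω (M : ℤ) =>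
        fwd (R : (A'.fibre s').toAbelianVariety.Points Ω)) hPQ
      simp only [hbwdT, hfb] at h
      exact Subtype.ext h
    have hsurj : Function.Surjective (bwdT M) := fun Q => by
      have hQ' : fwd Q ∈ (A.fibre s).toAbelianVariety.torsionPoints Ω (M : ℤ) := by
        rw [AbelianVariety.mem_torsionPoints_iff, ← map_zpow, (AbelianVariety.mem_torsionPoints_iff _ _).1 Q.2,
          map_one]
      refine ⟨⟨fwd Q, hQ'⟩, Subtype.ext ?_⟩
      rw [hbwdT]
      exact hbf Q
    rw [MonoidHom.coe_comp]
    exact (show Function.Bijective (bwdT M) from ⟨hinj, hsurj⟩).comp (Λ.lift_bijective hM hM₀)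
  · -- tower compatibility
    intro M k x hM hM₀ hk
    change bwd _ = (bwd _ : (A'.fibre s').toAbelianVariety.Points Ω) ^ k
    rw [← map_pow]
    exact congrArg bwd (Λ.lift_compat k x hM hM₀ hk)
  · -- level `N`: `e⁻¹(σᵢ(s)) = σ′ᵢ(s′)`
    intro i
    change bwd ((Λ.lift N (Multiplicative.ofAdd (Pi.single i 1)) :
        (A.fibre s).toAbelianVariety.torsionPoints Ω (N : ℤ)) : (A.fibre s).toAbelianVariety.Points Ω) = _
    rw [Λ.lift_level i, ← he i, ← hfwd, hbf]
  · -- the pairing clause: `ē^{e^*Θ}(e⁻¹P, e⁻¹Q) = ē^Θ(P, Q) = ζ_M ^ E_δ`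
    intro M hM hMΩ x y
    haveI := AbelianVariety.isDominant_toSchemeHom_zsmul_of_ne_zero (A'.fibre s').toAbelianVariety hMΩ
    haveI := AbelianVariety.isDominant_toSchemeHom_zsmul_of_ne_zero (A.fibre s).toAbelianVariety hMΩ
    have hP : ((Λ.lift M (Multiplicative.ofAdd x) : (A.fibre s).toAbelianVariety.torsionPoints Ω (M : ℤ)) :
          (A.fibre s).toAbelianVariety.Points Ω) =
        AlgPoints.map e.hom.hom.hom.hom
          (((bwdT M).comp (Λ.lift M) (Multiplicative.ofAdd x) :
              (A'.fibre s').toAbelianVariety.torsionPoints Ω (M : ℤ)) :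
            (A'.fibre s').toAbelianVariety.Points Ω) := by
      rw [MonoidHom.comp_apply, hbwdT, ← hfwd, hfb]
    have hQ : ((Λ.lift M (Multiplicative.ofAdd y) : (A.fibre s).toAbelianVariety.torsionPoints Ω (M : ℤ)) :
          (A.fibre s).toAbelianVariety.Points Ω) =
        AlgPoints.map e.hom.hom.hom.hom
          (((bwdT M).comp (Λ.lift M) (Multiplicative.ofAdd y) :
              (A'.fibre s').toAbelianVariety.torsionPoints Ω (M : ℤ)) :
            (A'.fibre s').toAbelianVariety.Points Ω) := by
      rw [MonoidHom.comp_apply, hbwdT, ← hfwd, hfb]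
    have key := AbelianVariety.weilPairingLevel_pullback_eq e.hom Θ
      ((bwdT M).comp (Λ.lift M) (Multiplicative.ofAdd x)) ((bwdT M).comp (Λ.lift M) (Multiplicative.ofAdd y))
      (Λ.lift M (Multiplicative.ofAdd x)) (Λ.lift M (Multiplicative.ofAdd y)) hP hQ
    have hΛ := Λ.weilPairingLevel_lift hM hMΩ x y
    convert key.trans hΛ using 1

/-- **(T2) SYMPLECTIC-LIFTABILITY TRANSFERS along a family of fibre isomorphisms compatible with the level sections
and with the polarisations** ([Lan2013PELCompactifications] Lemma 1.3.6.6: liftability is tested geometric point by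
geometric point, and at a geometric point it is a statement about the fibre `A_s̄` with its induced polarisation
and sections).  Given `f : S′ → S`, for every algebraically closed point `s′` of `S′` an isomorphism
`e : A′_{s′} ≅ A_{s′ ≫ f}` carrying `φ′(s′)` to `φ(s′ ≫ f)` (`he`), and the POLARISATION TRANSFER `hpol` — every ample
witness `Θ′` of `λ̄′` at `s′` pulls back along `e⁻¹` to an ample witness of `λ̄` at `s′ ≫ f` — if `φ` is
symplectic-liftable of type `δ` for `pol` then so is `φ′` for `pol′`.  (Proof: lift for `(e⁻¹)^*Θ′` by hypothesis,
transport it along `e` by (T1) to `e^*(e⁻¹)^*Θ′`, which is the same divisor as `Θ′`; conclude by (T0).)  The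
assembler instantiates `A′ := A.baseChange f`, `φ′ := φ.baseChange f`, `pol′ := pol.baseChange f` with the D1/D2
thirds' `e`, `he`, `hpol`. [cite: Lan2013PELCompactifications, §1.3.6 Lemma 1.3.6.6 and Cor. 1.3.6.7 (pp. 81–82)]
[cite: MumfordAV1970, §20 (property (3) of e_n, p. 186)] -/
theorem LevelStructure.IsSymplecticLiftable.of_fibreIso {D : A.DualPair} {pol : A.Polarization D}
    {D' : A'.DualPair} {pol' : A'.Polarization D'} (f : S' ⟶ S)
    (e : ∀ (Ω : Type u) [Field Ω] [IsAlgClosed Ω] (s' : Spec (.of Ω) ⟶ S'),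
      (A'.fibre s').toAbelianVariety ≅ (A.fibre (s' ≫ f)).toAbelianVariety)
    (he : ∀ (Ω : Type u) [Field Ω] [IsAlgClosed Ω] (s' : Spec (.of Ω) ⟶ S') (i : Fin g ⊕ Fin g),
      AlgPoints.map (e Ω s').hom.hom.hom.hom (A'.restrictPt s' (φ'.σ i)) = A.restrictPt (s' ≫ f) (φ.σ i))
    (hpol : ∀ (Ω : Type u) [Field Ω] [IsAlgClosed Ω] (s' : Spec (.of Ω) ⟶ S')
      (Θ' : CartierDivisor (A'.fibre s').toAbelianVariety.X.left), Θ'.IsAmple → A'.IsLambdaOfAt s' D' pol'.lam Θ' →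
      haveI : IsDominant (AbelianVariety.Hom.toSchemeHom (e Ω s').inv) :=
        AbelianVariety.isDominant_toSchemeHom_iso_hom (e Ω s').symm
      (Θ'.pullback (AbelianVariety.Hom.toSchemeHom (e Ω s').inv)).IsAmple ∧
        A.IsLambdaOfAt (s' ≫ f) D pol.lam (Θ'.pullback (AbelianVariety.Hom.toSchemeHom (e Ω s').inv)))
    (h : φ.IsSymplecticLiftable pol δ) : φ'.IsSymplecticLiftable pol' δ := by
  intro Ω _ _ s' Θ' hΘ' hlam'
  haveI h₁ := AbelianVariety.isDominant_toSchemeHom_iso_hom (e Ω s')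
  haveI h₂ : IsDominant (AbelianVariety.Hom.toSchemeHom (e Ω s').inv) :=
    AbelianVariety.isDominant_toSchemeHom_iso_hom (e Ω s').symm
  obtain ⟨hΘ, hlam⟩ := hpol Ω s' Θ' hΘ' hlam'
  obtain ⟨Λ⟩ := h Ω (s' ≫ f) _ hΘ hlam
  obtain ⟨Λ'⟩ := Λ.nonempty_transport (φ' := φ') (e Ω s') (he Ω s')
  -- `e^*(e⁻¹)^*Θ′` is the same divisor as `Θ′`
  have hsame : ((Θ'.pullback (AbelianVariety.Hom.toSchemeHom (e Ω s').inv)).pullback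
      (AbelianVariety.Hom.toSchemeHom (e Ω s').hom)).SameDivisor Θ' := by
    refine (Θ'.pullback_pullback_sameDivisor _ _).trans ?_
    have hcomp : AbelianVariety.Hom.toSchemeHom (e Ω s').hom ≫ AbelianVariety.Hom.toSchemeHom (e Ω s').inv =
        𝟙 _ := by
      change AbelianVariety.Hom.toSchemeHom ((e Ω s').hom ≫ (e Ω s').inv) = _
      rw [(e Ω s').hom_inv_id]
      rfl
    exact (Θ'.pullback_congr_sameDivisor hcomp).trans Θ'.pullback_id_sameDivisor
  exact Λ'.nonempty_of_linEquiv hsame.linEquiv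

end AbelianSchemeOver

end Literature.AlgebraicGeometry.AbelianSchemes

end
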